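import Mathlib
import Summits.ValiantsHypothesis.ValiantsHypothesis.Theorems.NewtonUnitEquationsDissociatedUniformTotalsLaw
import Summits.ValiantsHypothesis.ValiantsHypothesis.Theorems.NewtonUnitEquationsDissociatedUniformTotalsLawUnimodal
import Summits.ValiantsHypothesis.ValiantsHypothesis.Theorems.NewtonUnitEquationsDissociatedUniformTotalsLawUnionConverse
import Summits.ValiantsHypothesis.ValiantsHypothesis.Theorems.NewtonUnitEquationsDissociatedUniformTotalsLawHexagon
import Summits.ValiantsHypothesis.ValiantsHypothesis.Theorems.NewtonUnitEquationsDissociatedUniformTotalsLawHexagonCount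
import Summits.ValiantsHypothesis.ValiantsHypothesis.Theorems.NewtonUnitEquationsDissociatedUniformTotalsLawTriangles
import Literature.Computability.AlgebraicComplexity.NewtonPolygonTauProductBounds
import HarnessLib

/-!
# Crux `NewtonUnitEquations.DissociatedUniform` (stmt-ValiantsHypothesis-5905), `n = 3` totals law of model (Q**):
# HEXAGON-TOPS — the sharpest local relaxation `T ≤ N_△ ≤ #HT ≤ #mixed`, and the located SHARP conjecture on the smooth stratum

`HexTop a b c x y z`: some weight `w` puts all six triangular-lattice neighbours of `v = a x + b y + c z` strictly below `v` — `v` is a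
LOCAL strict maximum of `⟨w, ·⟩` on the torus of class `x + y + z` (equivalently: `v` is a vertex of the convex hull of its 7-point star;
equivalently: the label triple is a local pairwise top of the three pair fibres at a common weight).  This file places it in the chain of
relaxations of this seat:

  `T ≤ N_△ ≤ #HT ≤ #mixed ≤ N_a + N_b + N_c`

(`hexTop_of_triTop`, `hexMixed_of_hexTop`, `totalVert_le_hexTopCount`, `triangleCount_le_hexTopCount`, `hexTopCount_le_sum_hexMixed`).
CENSUS (this seat, `exp/ht.py`, `ht2.py`; exact local hulls): on the HODOGRAPH-CONVEX stratum `#HT/q² ∈ [1.91, 2.11]` in every family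
tested, q ≤ 31 — regular polygons of radii 10⁴/7·10³/10⁸: `#HT = T = 2q²` exactly; circles R, R/3, R/10: `#HT = T = 1.91–1.94 q²`;
three equal circles: `#HT = T = 3q` (!); three parabolas: `T = 1.35–1.45 q² < #HT = 2.02–2.04 q²`; RANDOM convex hodographs (random
angles on a circle / ellipse, three scales or equal scales): `#HT = 1.91–2.11 q²` while `T = 0.66–2.00 q²` — whereas the sign-change
count `N_a+N_b+N_c` of the landed theorem ranges over `4–5.8 q²`.  Off the stratum `#HT` is cubic (random points `6.8, 10.4, 14.3 q²`
at q = 11, 17, 23; a multiplier-2 circle `2.6–2.7 q²`).  The number of hexagon-tops of ONE class at ONE weight is NOT bounded (up to 7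
observed for random convex hodographs at q = 17), so the conjectured bound is an amortised (kinetic) statement:
`@[conjecture] HexTopSharp C`: hodograph-convex ⇒ `#HT ≤ 2q² + C q`, which would give the SHARP law `T ≤ 2q² + Cq`
(`SharpTotalsLawThree` shape) on the smooth stratum (`totalVert_le_of_hexTopSharp`).  OPEN, asserted nowhere; `TotalsLawThree C` for
arbitrary labellings remains OPEN; VP ≠ VNP is not touched.
[folklore: a strict maximiser over a set is a strict maximiser over every subset containing it]
-/

set_option linter.dupNamespace false -- `ValiantsHypothesis.ValiantsHypothesis` (summit = problem) in every name

open scoped BigOperators Pointwise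

namespace Summit.ValiantsHypothesis.ValiantsHypothesis.Theorems.NewtonUnitEquationsDissociatedUniform

namespace TotalsLaw

open Literature.Computability.AlgebraicComplexity.KPTT.PlanarMinkowski Matrix

section HexTop

variable {q : ℕ} [NeZero q]

/-- `n` is STRICTLY BELOW `v` for the weight `w` unless it is the same point. -/
def Below (w v n : Fin 2 → ℝ) : Prop := n ≠ v → w ⬝ᵥ (n - v) < 0

/-- `(x, y, z)` is a HEXAGON-TOP: for some weight `w` the six lattice neighbours `a(x±1)+…` of `v = a x + b y + c z` (moves
`(±1,0,∓1), (0,±1,∓1), (∓1,±1,0)`) are strictly below `v` (neighbours that coincide with `v` as points impose nothing). -/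
def HexTop (a b c : ZMod q → (Fin 2 → ℝ)) (x y z : ZMod q) : Prop :=
  ∃ w : Fin 2 → ℝ,
    Below w (a x + b y + c z) (a (x + 1) + b y + c (z - 1)) ∧ Below w (a x + b y + c z) (a x + b (y + 1) + c (z - 1)) ∧
      Below w (a x + b y + c z) (a (x - 1) + b (y + 1) + c z) ∧ Below w (a x + b y + c z) (a (x - 1) + b y + c (z + 1)) ∧
        Below w (a x + b y + c z) (a x + b (y - 1) + c (z + 1)) ∧ Below w (a x + b y + c z) (a (x + 1) + b (y - 1) + c z)

/-- `#HT`: the number of hexagon-tops. -/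
noncomputable def hexTopCount (a b c : ZMod q → (Fin 2 → ℝ)) : ℕ :=
  ∑ x : ZMod q, ∑ y : ZMod q, ∑ z : ZMod q, indic (HexTop a b c x y z)

/-- **Located sharp conjecture on the smooth stratum**: if the three hodographs are convexly ordered then `#HT ≤ 2q² + C q`
(census: `#HT/q² ≤ 2.11` for q ≤ 31 in all smooth families; equality `#HT = T = 2q²` in both extreme regimes).  OPEN; asserted nowhere. -/
@[conjecture] def HexTopSharp (C : ℕ) : Prop :=
  ∀ (q : ℕ) [NeZero q] (a b c : ZMod q → (Fin 2 → ℝ)), ConvexlyOrdered (edgeVec a) → ConvexlyOrdered (edgeVec b) →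
    ConvexlyOrdered (edgeVec c) → hexTopCount a b c ≤ 2 * q ^ 2 + C * q

variable (a b c : ZMod q → (Fin 2 → ℝ))

omit [NeZero q] in
/-- A strict top of a finite set puts every member below it. [folklore] -/
theorem below_of_isStrictTop {w v n : Fin 2 → ℝ} {F : Finset (Fin 2 → ℝ)} (h : IsStrictTop w F v) (hn : n ∈ F) : Below w v n :=
  fun hne => dotProduct_sub_neg_of_isStrictTop h hn hne

/-- **A class-hull vertex is a hexagon-top** (its exposing weight works: the neighbours are class points). [folklore] -/
theorem hexTop_of_mem_extremePoints {s x y : ZMod q}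
    (h : a x + b y + c (s - x - y) ∈ (convexHull ℝ (classPts a b c s)).extremePoints ℝ) : HexTop a b c x y (s - x - y) := by
  classical
  set z := s - x - y with hz
  rw [← coe_classFin] at h
  obtain ⟨w, hw⟩ := exists_isStrictTop_of_mem_extremePoints h
  exact ⟨w, below_of_isStrictTop hw (mem_classFin_of_sum_eq (by rw [hz]; ring)),
    below_of_isStrictTop hw (mem_classFin_of_sum_eq (by rw [hz]; ring)),
    below_of_isStrictTop hw (mem_classFin_of_sum_eq (by rw [hz]; ring)),
    below_of_isStrictTop hw (mem_classFin_of_sum_eq (by rw [hz]; ring)),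
    below_of_isStrictTop hw (mem_classFin_of_sum_eq (by rw [hz]; ring)),
    below_of_isStrictTop hw (mem_classFin_of_sum_eq (by rw [hz]; ring))⟩

omit [NeZero q] in
/-- Transport of `Below` along equal differences: if `n - v = p - v'` and `v'` strictly tops a set containing `p`. [folklore] -/
theorem below_of_pair {w v' p n v : Fin 2 → ℝ} {F : Finset (Fin 2 → ℝ)} (ht : IsStrictTop w F v') (hp : p ∈ F)
    (he : n - v = p - v') : Below w v n := by
  intro hne
  rw [he]
  refine dotProduct_sub_neg_of_isStrictTop ht hp ?_
  intro hpv
  apply hne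
  have : n - v = 0 := by rw [he, hpv, sub_self]
  exact sub_eq_zero.1 this

/-- **A triangle (pairwise top) is a hexagon-top**: the six neighbours are pair-fibre competitors. [folklore] -/
theorem hexTop_of_triTop {x y z : ZMod q} (h : TriTop a b c x y z) : HexTop a b c x y z := by
  obtain ⟨w, hP, hQ, hR⟩ := h
  have m₁ : a (x + 1) + c (z - 1) ∈ fibreFin a c (x + z) := mem_fibreFin_of_sum_eq (by ring)
  have m₂ : b (y + 1) + c (z - 1) ∈ fibreFin b c (y + z) := mem_fibreFin_of_sum_eq (by ring)
  have m₃ : a (x - 1) + b (y + 1) ∈ fibreFin a b (x + y) := mem_fibreFin_of_sum_eq (by ring)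
  have m₄ : a (x - 1) + c (z + 1) ∈ fibreFin a c (x + z) := mem_fibreFin_of_sum_eq (by ring)
  have m₅ : b (y - 1) + c (z + 1) ∈ fibreFin b c (y + z) := mem_fibreFin_of_sum_eq (by ring)
  have m₆ : a (x + 1) + b (y - 1) ∈ fibreFin a b (x + y) := mem_fibreFin_of_sum_eq (by ring)
  have e₁ : a (x + 1) + b y + c (z - 1) - (a x + b y + c z) = a (x + 1) + c (z - 1) - (a x + c z) := by abel
  have e₂ : a x + b (y + 1) + c (z - 1) - (a x + b y + c z) = b (y + 1) + c (z - 1) - (b y + c z) := by abel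
  have e₃ : a (x - 1) + b (y + 1) + c z - (a x + b y + c z) = a (x - 1) + b (y + 1) - (a x + b y) := by abel
  have e₄ : a (x - 1) + b y + c (z + 1) - (a x + b y + c z) = a (x - 1) + c (z + 1) - (a x + c z) := by abel
  have e₅ : a x + b (y - 1) + c (z + 1) - (a x + b y + c z) = b (y - 1) + c (z + 1) - (b y + c z) := by abel
  have e₆ : a (x + 1) + b (y - 1) + c z - (a x + b y + c z) = a (x + 1) + b (y - 1) - (a x + b y) := by abel
  exact ⟨w, below_of_pair hR m₁ e₁, below_of_pair hQ m₂ e₂, below_of_pair hP m₃ e₃, below_of_pair hR m₄ e₄,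
    below_of_pair hQ m₅ e₅, below_of_pair hP m₆ e₆⟩

omit [NeZero q] in
/-- **A hexagon-top has a mixed hexagon** (`six_turn`; a coinciding neighbour makes an orientation vanish). [folklore] -/
theorem hexMixed_of_hexTop {x y z : ZMod q} (h : HexTop a b c x y z) : HexMixed a b c x y z := by
  obtain ⟨w, b₁, b₂, b₃, b₄, b₅, b₆⟩ := h
  constructor
  · rintro ⟨o₁, o₂, o₃, o₄, o₅, o₆⟩
    rw [← cross2_hexagon₁ a b c x y z] at o₁
    rw [← cross2_hexagon₂ a b c x y z] at o₂
    rw [← cross2_hexagon₃ a b c x y z] at o₃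
    rw [← cross2_hexagon₄ a b c x y z] at o₄
    rw [← cross2_hexagon₅ a b c x y z] at o₅
    rw [← cross2_hexagon₆ a b c x y z] at o₆
    exact six_turn o₁ o₂ o₃ o₄ o₅ o₆ (b₁ (ne_of_cross2_ne_zero_left o₁.ne')) (b₂ (ne_of_cross2_ne_zero_left o₂.ne'))
      (b₃ (ne_of_cross2_ne_zero_left o₃.ne')) (b₄ (ne_of_cross2_ne_zero_left o₄.ne'))
      (b₅ (ne_of_cross2_ne_zero_left o₅.ne')) (b₆ (ne_of_cross2_ne_zero_left o₆.ne'))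
  · rintro ⟨o₁, o₂, o₃, o₄, o₅, o₆⟩
    rw [← cross2_hexagon₁ a b c x y z] at o₁
    rw [← cross2_hexagon₂ a b c x y z] at o₂
    rw [← cross2_hexagon₃ a b c x y z] at o₃
    rw [← cross2_hexagon₄ a b c x y z] at o₄
    rw [← cross2_hexagon₅ a b c x y z] at o₅
    rw [← cross2_hexagon₆ a b c x y z] at o₆
    have r₁ := (cross2_swap _ _).symm ▸ neg_pos.2 o₁
    have r₂ := (cross2_swap _ _).symm ▸ neg_pos.2 o₂
    have r₃ := (cross2_swap _ _).symm ▸ neg_pos.2 o₃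
    have r₄ := (cross2_swap _ _).symm ▸ neg_pos.2 o₄
    have r₅ := (cross2_swap _ _).symm ▸ neg_pos.2 o₅
    have r₆ := (cross2_swap _ _).symm ▸ neg_pos.2 o₆
    exact six_turn r₆ r₅ r₄ r₃ r₂ r₁ (b₁ (ne_of_cross2_ne_zero_left o₁.ne)) (b₆ (ne_of_cross2_ne_zero_left o₆.ne))
      (b₅ (ne_of_cross2_ne_zero_left o₅.ne)) (b₄ (ne_of_cross2_ne_zero_left o₄.ne))
      (b₃ (ne_of_cross2_ne_zero_left o₃.ne)) (b₂ (ne_of_cross2_ne_zero_left o₂.ne))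

/-- **`T ≤ #HT`.** [folklore] -/
theorem totalVert_le_hexTopCount : totalVert a b c ≤ hexTopCount a b c := by
  classical
  have hcls : ∀ s : ZMod q, classVert a b c s ≤ ∑ x : ZMod q, ∑ y : ZMod q, indic (HexTop a b c x y (s - x - y)) := by
    intro s
    unfold classVert
    set E := (convexHull ℝ (classPts a b c s)).extremePoints ℝ with hE
    set φ : ZMod q × ZMod q → (Fin 2 → ℝ) := fun xy => a xy.1 + b xy.2 + c (s - xy.1 - xy.2) with hφ
    set M : Finset (ZMod q × ZMod q) := Finset.univ.filter fun xy => HexTop a b c xy.1 xy.2 (s - xy.1 - xy.2) with hM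
    have hsub : E ⊆ φ '' (M : Set (ZMod q × ZMod q)) := by
      intro p hp
      have hp' : p ∈ classPts a b c s := extremePoints_convexHull_subset hp
      obtain ⟨xy, rfl⟩ := hp'
      refine ⟨xy, ?_, rfl⟩
      rw [Finset.mem_coe, hM, Finset.mem_filter]
      exact ⟨Finset.mem_univ _, hexTop_of_mem_extremePoints a b c hp⟩
    have hfin : (φ '' (M : Set (ZMod q × ZMod q))).Finite := M.finite_toSet.image φ
    calc E.ncard ≤ (φ '' (M : Set (ZMod q × ZMod q))).ncard := Set.ncard_le_ncard hsub hfin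
      _ ≤ (M : Set (ZMod q × ZMod q)).ncard := Set.ncard_image_le M.finite_toSet
      _ = M.card := Set.ncard_coe_finset M
      _ = ∑ xy : ZMod q × ZMod q, indic (HexTop a b c xy.1 xy.2 (s - xy.1 - xy.2)) := by rw [hM, Finset.card_filter]; rfl
      _ = ∑ x : ZMod q, ∑ y : ZMod q, indic (HexTop a b c x y (s - x - y)) := Fintype.sum_prod_type _
  unfold totalVert hexTopCount
  calc ∑ s, classVert a b c s ≤ ∑ s : ZMod q, ∑ x : ZMod q, ∑ y : ZMod q, indic (HexTop a b c x y (s - x - y)) :=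
        Finset.sum_le_sum fun s _ => hcls s
    _ = ∑ x : ZMod q, ∑ s : ZMod q, ∑ y : ZMod q, indic (HexTop a b c x y (s - x - y)) := Finset.sum_comm
    _ = ∑ x : ZMod q, ∑ y : ZMod q, ∑ s : ZMod q, indic (HexTop a b c x y (s - x - y)) :=
        Finset.sum_congr rfl fun x _ => Finset.sum_comm
    _ = ∑ x : ZMod q, ∑ y : ZMod q, ∑ z : ZMod q, indic (HexTop a b c x y z) :=
        Finset.sum_congr rfl fun x _ => Finset.sum_congr rfl fun y _ => sum_sub_sub_eq (fun z => indic (HexTop a b c x y z)) x y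

/-- **`N_△ ≤ #HT`.** [folklore] -/
theorem triangleCount_le_hexTopCount : triangleCount a b c ≤ hexTopCount a b c := by
  unfold triangleCount hexTopCount
  exact Finset.sum_le_sum fun x _ => Finset.sum_le_sum fun y _ => Finset.sum_le_sum fun z _ =>
    indic_mono (hexTop_of_triTop a b c)

/-- **`#HT ≤ #mixed`.** [folklore] -/
theorem hexTopCount_le_sum_hexMixed :
    hexTopCount a b c ≤ ∑ x : ZMod q, ∑ y : ZMod q, ∑ z : ZMod q, indic (HexMixed a b c x y z) := by
  unfold hexTopCount
  exact Finset.sum_le_sum fun x _ => Finset.sum_le_sum fun y _ => Finset.sum_le_sum fun z _ =>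
    indic_mono (hexMixed_of_hexTop a b c)

/-- **The sharp law on the smooth stratum follows from `HexTopSharp`**: `T ≤ 2q² + Cq` whenever the three hodographs are convexly
ordered. -/
theorem totalVert_le_of_hexTopSharp (C : ℕ) (h : HexTopSharp C) (ha : ConvexlyOrdered (edgeVec a)) (hb : ConvexlyOrdered (edgeVec b))
    (hc : ConvexlyOrdered (edgeVec c)) : totalVert a b c ≤ 2 * q ^ 2 + C * q :=
  (totalVert_le_hexTopCount a b c).trans (h q a b c ha hb hc)

end HexTop

/-! ### Addendum (same seat, adversarial census INSIDE the smooth stratum)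

Annealing over hodograph-convex triples themselves (hodograph vertices on random ellipses, angles / axes / scales annealed; `exp/anneal_smooth.py`,
1–6·10⁴ steps per run) gives `#HT/q² = 2.65, 2.74, 2.79, 2.77` at `q = 7, 9, 11, 13` (with `T/q² ≈ 1.4–1.8` in those maximisers), while the
TOTALS never exceeded `2q²` EXACTLY (`q = 9, 11, 13`, up to 6·10⁴ steps) and `max_s V_s = 2q + 6, 7, 8, 9` (`q = 11, 13, 17, 23`).  So
`HexTopSharp C` above is expected to FAIL for every fixed `C` (the excess of `#HT` over `2q²` is quadratic, ≈ 0.75q², not linear); it is kept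
for the record, and the located statements are the two below: the local count is `O(q²)` with a constant `≤ 3` in all data (which would
improve the landed `6` to `3`), and the SHARP constant `2` belongs to `T` itself, not to any local count. -/

/-- **Located local bound** `#HT ≤ C q²` on the smooth stratum (census: structured families 1.91–2.11 q², adversarial annealing inside the
stratum 2.65–2.79 q² for q ≤ 13; `C = 3` never violated).  OPEN; asserted nowhere. -/
@[conjecture] def HexTopBound (C : ℕ) : Prop :=
  ∀ (q : ℕ) [NeZero q] (a b c : ZMod q → (Fin 2 → ℝ)), ConvexlyOrdered (edgeVec a) → ConvexlyOrdered (edgeVec b) →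
    ConvexlyOrdered (edgeVec c) → hexTopCount a b c ≤ C * q ^ 2

/-- **Located SHARP law on the smooth stratum**: hodograph-convex ⇒ `T ≤ 2q² + C q` (census: every structured family ≤ 2.00 q², and
adversarial annealing INSIDE the stratum reached exactly `2q²` and never more, q ≤ 13; both extreme regimes attain `2q²`, so `2` is sharp).
OPEN; asserted nowhere. -/
@[conjecture] def SmoothSharpTotalsLaw (C : ℕ) : Prop :=
  ∀ (q : ℕ) [NeZero q] (a b c : ZMod q → (Fin 2 → ℝ)), ConvexlyOrdered (edgeVec a) → ConvexlyOrdered (edgeVec b) →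
    ConvexlyOrdered (edgeVec c) → totalVert a b c ≤ 2 * q ^ 2 + C * q

section HexTopBound

variable {q : ℕ} [NeZero q] (a b c : ZMod q → (Fin 2 → ℝ))

/-- `HexTopBound C` gives `T ≤ C q²` on the smooth stratum (through `T ≤ #HT`). -/
theorem totalVert_le_of_hexTopBound (C : ℕ) (h : HexTopBound C) (ha : ConvexlyOrdered (edgeVec a)) (hb : ConvexlyOrdered (edgeVec b))
    (hc : ConvexlyOrdered (edgeVec c)) : totalVert a b c ≤ C * q ^ 2 :=
  (totalVert_le_hexTopCount a b c).trans (h q a b c ha hb hc)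

/-- `HexTopSharp C` implies `HexTopBound (C + 2)` (bookkeeping). -/
theorem hexTopBound_of_hexTopSharp (C : ℕ) (h : HexTopSharp C) : HexTopBound (C + 2) := by
  intro q _ a b c ha hb hc
  have h1 := h q a b c ha hb hc
  have hq : q ≤ q ^ 2 := by
    rcases Nat.eq_zero_or_pos q with h0 | hpos
    · simp [h0]
    · calc q = q * 1 := (mul_one q).symm
        _ ≤ q * q := Nat.mul_le_mul_left q hpos
        _ = q ^ 2 := (sq q).symm
  calc hexTopCount a b c ≤ 2 * q ^ 2 + C * q := h1
    _ ≤ 2 * q ^ 2 + C * q ^ 2 := by gcongr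
    _ = (C + 2) * q ^ 2 := by ring

/-- `SmoothSharpTotalsLaw C` is implied by `HexTopSharp C` (for the record; the hypothesis is expected to be false). -/
theorem smoothSharpTotalsLaw_of_hexTopSharp (C : ℕ) (h : HexTopSharp C) : SmoothSharpTotalsLaw C :=
  fun _ _ a b c ha hb hc => totalVert_le_of_hexTopSharp a b c C h ha hb hc

end HexTopBound

end TotalsLaw

end Summit.ValiantsHypothesis.ValiantsHypothesis.Theorems.NewtonUnitEquationsDissociatedUniform
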